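import Summits.QuantumFields.QCD.Theses.GapBuysCauchyRate
import Literature.MathematicalPhysics.QuantumFieldTheory.GaugeCovariantBlockMap

/-!
# Stub `stub_calibratedFamily` of line `birth` for crux `GapBuysCauchyRate.LadderCauchyRate`
(item stmt-QuantumFields-17307, route route-QuantumFields-GapBuysCauchyRate, sub-problem QCD)

What is proved: INHABITATION of `CalibratedSpeciesFamily reg` by the PINNED family, conditional on the
one-point law U (torus one-point expectations `⟨O_s(x)⟩` are site-independent and real) and species
multilinearity E1 (renormalised one- and two-point functions scale as `z_s`, `z_s²`; the bare one-point
function is the lattice sum of `⟨O_s(x)⟩ − shift_s⟨1⟩`).  For every `reg`, `τ₀ > 0`, `f₀ ≠ 0` in the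
slab `τ₀/2 ≤ x⁰ ≤ τ₀` and positive default `ζ`: `shift_s(m,k) := Re ⟨O_s(0)⟩_{k,m}`, `z_s(m,k) :=
(Re C₁)^{-1/2}` if the bare connected calibrating function `C₁ = ⟨Φ^s(Θf₀)Φ^s(f₀)⟩_conn` (`z ≡ 1`) is
a positive real, else `ζ_s(m,k)`.  One-point subtraction: by E1 and U the renormalised one-point function
is `z Σ_x c_x (⟨O_s(0)⟩ − ⟨O_s(0)⟩⟨1⟩) = 0` (`⟨1⟩ = Z/Z`, junk `0` when `Z = 0`).  Calibration: by E1
the renormalised connected function is `z² C₁`: `= 1` on the positive-real branch (`(√r)⁻² r = 1`), never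
a positive real on the other (`ζ² > 0`).  Source: Montvay–Münster 1994 §1.7 (1.251)–(1.253), §5.1.

Pure theorem file (no definitions): the registered stub signature, proved in tree vocabulary.
-/

noncomputable section

namespace Summit.QuantumFields.QCD.Cruxes.LadderCauchyRate.Birth

open scoped BigOperators Topology Classical
open MeasureTheory Filter
open Literature.MathematicalPhysics.AQFT Literature.Probability.LatticeModels
  Literature.MathematicalPhysics.QuantumLattice Literature.MathematicalPhysics.QuantumFieldTheory
open Summit.QuantumFields.QCD.Theses.GapBuysCauchyRate

/-- A complex number with vanishing imaginary part is the cast of its real part. -/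
private theorem ofReal_re_eq_self_of_im_eq_zero {w : ℂ} (h : w.im = 0) : ((w.re : ℝ) : ℂ) = w :=
  Complex.ext (Complex.ofReal_re _) (by rw [Complex.ofReal_im, h])

/-- The calibration arithmetic: for a positive real `w`, `(√(Re w))⁻² · w = 1`. -/
private theorem ofReal_inv_sqrt_sq_mul_eq_one {w : ℂ} (hr : 0 < w.re) (hi : w.im = 0) :
    (((Real.sqrt w.re)⁻¹ : ℝ) : ℂ) ^ 2 * w = 1 := by
  rw [← Complex.ofReal_pow, inv_pow, Real.sq_sqrt hr.le]
  apply Complex.ext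
  · rw [Complex.re_ofReal_mul, Complex.one_re, inv_mul_cancel₀ hr.ne']
  · rw [Complex.im_ofReal_mul, Complex.one_im, hi, mul_zero]

/-- `a/b − (a/b)·(b/b) = 0`: `b/b = 1` unless `b = 0`, when `a/b` is the junk value `0`. -/
private theorem div_sub_div_mul_div_self_eq_zero (a b : ℂ) : a / b - a / b * (b / b) = 0 := by
  rcases eq_or_ne b 0 with rfl | hb
  · rw [div_zero, zero_mul, sub_zero]
  · rw [div_self hb, mul_one, sub_self]

/-- For the honest torus functional, `⟨X⟩ − ⟨X⟩·⟨1⟩ = 0`: `⟨1⟩ = Z/Z` is `1` unless the partition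
function `Z` vanishes, in which case every expectation is the junk value `0`. -/
private theorem qcdTorusExpect_sub_mul_one {Nf S : ℕ} [NeZero S] (β : ℝ) (mq : Fin Nf → ℝ)
    (X : GaugeConfig 4 S (Matrix.specialUnitaryGroup (Fin 3) ℂ) → FermiAlg Nf S) :
    qcdTorusExpect β S mq X - qcdTorusExpect β S mq X * qcdTorusExpect β S mq (fun _ => 1) = 0 := by
  unfold qcdTorusExpect
  simp only [one_mul]
  exact div_sub_div_mul_div_self_eq_zero _ _

/-- (E2) **inhabitation by the pinned family** (size M, provable now: define `shift` and `z` by the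
pinning formulas; one-point subtraction from U and E1; calibration from E1).  Registered signature =
`OnePointLawStmt → SpeciesMultilinearStmt → InhabitationStmt` written out. -/
theorem stub_calibratedFamily :
    (∀ (Nf S : ℕ) (β : ℝ) (mq : Fin Nf → ℝ) (s : QCDField Nf) (x : Literature.Probability.LatticeModels.Site 4),
      qcdTorusExpect β (2 * S + 1) mq (fun U => insertion U s x) =
          qcdTorusExpect β (2 * S + 1) mq (fun U => insertion U s 0) ∧
        (qcdTorusExpect β (2 * S + 1) mq (fun U => insertion U s 0)).im = 0) →
    (∀ (Nf : ℕ) (reg : QCDRegularisation Nf) (m : Fin Nf → ℝ) (z shift : QCDField Nf → ℕ → ℝ) (k : ℕ)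
      (s : QCDField Nf) (g f : SchwartzMap (EuclideanSpace ℝ (Fin 4)) ℝ),
      (reg.scheme m z shift).onePoint k s f =
          ((z s k : ℝ) : ℂ) * (reg.scheme m (fun _ _ => (1 : ℝ)) shift).onePoint k s f ∧
      (reg.scheme m z shift).twoPoint k s s g f =
          ((z s k : ℝ) : ℂ) ^ 2 * (reg.scheme m (fun _ _ => (1 : ℝ)) shift).twoPoint k s s g f ∧
      (reg.scheme m (fun _ _ => (1 : ℝ)) shift).onePoint k s f =
          ∑ x ∈ Literature.Probability.LatticeModels.box 4 (reg.L k),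
            ((reg.a k ^ 4 * f (reg.a k • siteToE x) : ℝ) : ℂ) *
              (qcdTorusExpect (reg.β k) (2 * reg.L k + 1) (fun fl => (reg.scheme m 0 0).mq fl k)
                  (fun U => insertion U s x) -
                ((shift s k : ℝ) : ℂ) *
                  qcdTorusExpect (reg.β k) (2 * reg.L k + 1) (fun fl => (reg.scheme m 0 0).mq fl k)
                    (fun _ => 1))) →
    ∀ (Nf : ℕ) (reg : QCDRegularisation Nf) (τ₀ : ℝ), 0 < τ₀ →
      ∀ f₀ : SchwartzMap (EuclideanSpace ℝ (Fin 4)) ℝ, f₀ ≠ 0 →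
        tsupport (f₀ : EuclideanSpace ℝ (Fin 4) → ℝ) ⊆ timeSlab 4 (τ₀ / 2) τ₀ →
          ∀ ζ : (Fin Nf → ℝ) → QCDField Nf → ℕ → ℝ, (∀ m s k, 0 < ζ m s k) →
            ∃ 𝒞 : CalibratedSpeciesFamily reg, 𝒞.τ₀ = τ₀ ∧ 𝒞.f₀ = f₀ ∧
              (∀ (m : Fin Nf → ℝ) (s : QCDField Nf) (k : ℕ),
                𝒞.shift m s k =
                  (qcdTorusExpect (reg.β k) (2 * reg.L k + 1) (fun fl => (reg.scheme m 0 0).mq fl k)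
                    (fun U => insertion U s 0)).re) ∧
              (∀ (m : Fin Nf → ℝ) (s : QCDField Nf) (k : ℕ),
                ((0 < ((reg.scheme m (fun _ _ => (1 : ℝ)) (𝒞.shift m)).connectedTwoPoint k s s (thetaTest 4 𝒞.f₀) 𝒞.f₀).re ∧
                    ((reg.scheme m (fun _ _ => (1 : ℝ)) (𝒞.shift m)).connectedTwoPoint k s s (thetaTest 4 𝒞.f₀) 𝒞.f₀).im = 0) →
                  𝒞.z m s k =
                    (Real.sqrt ((reg.scheme m (fun _ _ => (1 : ℝ)) (𝒞.shift m)).connectedTwoPoint k s s (thetaTest 4 𝒞.f₀) 𝒞.f₀).re)⁻¹) ∧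
                (¬ (0 < ((reg.scheme m (fun _ _ => (1 : ℝ)) (𝒞.shift m)).connectedTwoPoint k s s (thetaTest 4 𝒞.f₀) 𝒞.f₀).re ∧
                    ((reg.scheme m (fun _ _ => (1 : ℝ)) (𝒞.shift m)).connectedTwoPoint k s s (thetaTest 4 𝒞.f₀) 𝒞.f₀).im = 0) →
                  𝒞.z m s k = ζ m s k)) := by
  intro hU hE1 Nf reg τ₀ hτ₀ f₀ hf₀ hsl ζ hζ
  -- the pinned additive counterterms `shift_s(m,k) = Re ⟨O_s(0)⟩_{k,m}`
  obtain ⟨shift, hshift⟩ : ∃ shift : (Fin Nf → ℝ) → QCDField Nf → ℕ → ℝ, ∀ m s k, shift m s k =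
      (qcdTorusExpect (reg.β k) (2 * reg.L k + 1) (fun fl => (reg.scheme m 0 0).mq fl k)
        (fun U => insertion U s 0)).re := ⟨_, fun _ _ _ => rfl⟩
  -- the bare (`z ≡ 1`) connected calibrating function `C₁`
  obtain ⟨C₁, hC₁⟩ : ∃ C₁ : (Fin Nf → ℝ) → QCDField Nf → ℕ → ℂ, ∀ m s k, C₁ m s k =
      (reg.scheme m (fun _ _ => (1 : ℝ)) (shift m)).connectedTwoPoint k s s (thetaTest 4 f₀) f₀ :=
    ⟨_, fun _ _ _ => rfl⟩
  -- the pinned multiplicative renormalisations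
  obtain ⟨z, hz⟩ : ∃ z : (Fin Nf → ℝ) → QCDField Nf → ℕ → ℝ, ∀ m s k, z m s k =
      if 0 < (C₁ m s k).re ∧ (C₁ m s k).im = 0 then (Real.sqrt (C₁ m s k).re)⁻¹ else ζ m s k :=
    ⟨_, fun _ _ _ => rfl⟩
  have hz_pos : ∀ m s k, 0 < z m s k := by
    intro m s k
    rw [hz]
    split_ifs with h
    · exact inv_pos.2 (Real.sqrt_pos.2 h.1)
    · exact hζ m s k
  -- one-point subtraction from E1 (parts 1, 3) and U
  have hone : IsOnePointSubtracted reg z shift := by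
    intro m s k f
    obtain ⟨h1, -, h3⟩ := hE1 Nf reg m (z m) (shift m) k s f f
    rw [h1, h3]
    refine mul_eq_zero_of_right _ (Finset.sum_eq_zero fun x _ => mul_eq_zero_of_right _ ?_)
    obtain ⟨hx, him⟩ := hU Nf (reg.L k) (reg.β k) (fun fl => (reg.scheme m 0 0).mq fl k) s x
    rw [hx, hshift m s k, ofReal_re_eq_self_of_im_eq_zero him]
    exact qcdTorusExpect_sub_mul_one _ _ _
  -- the scaling identity `C' = z² C₁` from E1 (parts 1, 2)
  have hscale : ∀ m s k, (reg.scheme m (z m) (shift m)).connectedTwoPoint k s s (thetaTest 4 f₀) f₀ =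
      ((z m s k : ℝ) : ℂ) ^ 2 * C₁ m s k := by
    intro m s k
    obtain ⟨h1f, h2, -⟩ := hE1 Nf reg m (z m) (shift m) k s (thetaTest 4 f₀) f₀
    obtain ⟨h1g, -, -⟩ := hE1 Nf reg m (z m) (shift m) k s f₀ (thetaTest 4 f₀)
    rw [hC₁]
    simp only [QCDScheme.connectedTwoPoint]
    rw [h2, h1g, h1f]
    ring
  -- calibration
  have hcal : IsCalibratedAt reg f₀ z shift := by
    intro m s k hre him
    rw [hscale] at hre him ⊢
    by_cases hpos : 0 < (C₁ m s k).re ∧ (C₁ m s k).im = 0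
    · rw [hz, if_pos hpos]
      exact ofReal_inv_sqrt_sq_mul_eq_one hpos.1 hpos.2
    · rw [hz, if_neg hpos, ← Complex.ofReal_pow] at hre him
      rw [Complex.re_ofReal_mul] at hre
      rw [Complex.im_ofReal_mul] at him
      have hζ2 : 0 < ζ m s k ^ 2 := pow_pos (hζ m s k) 2
      exact (hpos ⟨pos_of_mul_pos_right hre hζ2.le, (mul_eq_zero.1 him).resolve_left hζ2.ne'⟩).elim
  -- the pinning of `z`, in terms of `C₁`
  have hpin : ∀ m s k, ((0 < (C₁ m s k).re ∧ (C₁ m s k).im = 0) → z m s k = (Real.sqrt (C₁ m s k).re)⁻¹) ∧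
      (¬ (0 < (C₁ m s k).re ∧ (C₁ m s k).im = 0) → z m s k = ζ m s k) :=
    fun m s k => ⟨fun h => by rw [hz, if_pos h], fun h => by rw [hz, if_neg h]⟩
  refine ⟨⟨τ₀, hτ₀, f₀, hf₀, hsl, z, shift, hz_pos, hone, hcal⟩, rfl, rfl, hshift, fun m s k => ?_⟩
  have h := hpin m s k
  rw [hC₁] at h
  exact h

end Summit.QuantumFields.QCD.Cruxes.LadderCauchyRate.Birth

end
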